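import Literature.Topology.FourManifolds.SmoothHomologicalOrientation
import Literature.AlgebraicTopology.SingularHomology.LocalDegreeLinearization
import Literature.AlgebraicTopology.SingularHomology.LocalDegreeSign
import Literature.AlgebraicTopology.SingularHomology.LocalHomologyCharts
import Literature.AlgebraicTopology.SingularHomology.ExcisionTheorem
import HarnessLib

/-!
# Proof of `SmoothOrientation.existsUnique_isCompatible`: every smooth orientation has exactly one
compatible homological orientation

Sibling proof file of `Literature.Topology.FourManifolds.SmoothHomologicalOrientation` (D-0014):
it DISCHARGES the named fact
`Literature.Topology.FourManifolds.SmoothOrientation.existsUnique_isCompatible`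
(`theorem SmoothOrientation.existsUnique_isCompatible_holds`).

## Source

G. E. Bredon, *Topology and Geometry*, GTM 139 (1993), VI.7, Prop. 7.14 / Thm. 7.15: on a smooth
manifold the smooth orientations (atlases with positive Jacobians, equivalently consistent
orientations of the tangent spaces) correspond to the homological `ℤ`-orientations (consistent
generators of `Hₙ(M, M ∖ x; ℤ)`), by sending a positively oriented chart to the preferred
generator of `Hₙ(ℝⁿ, ℝⁿ ∖ pt)`; J. Milnor, J. Stasheff, *Characteristic Classes* (1974), App. A,
pp. 122–123 (the same dictionary). The analytic-topological heart is that a diffeomorphism acts on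
`Hₙ(ℝⁿ | p)` by the sign of its Jacobian determinant.

## Proof

With `φₓ = chartAt x`, `Aₓ = pushIncl x n : Hₙ(Uₓ | x) ⥲ Hₙ(M | x)` (excision) and
`Bₓ = pushChart x n : Hₙ(Uₓ | x) ⥲ Hₙ(ℝⁿ | φₓ x)` (open embedding), the compatible orientation
is forced to be `μₓ = Aₓ Bₓ⁻¹ (εₓ g_{φₓ x})`, `εₓ = 1` iff `o x` is the standard orientation;
this gives uniqueness and compatibility at once (`compatClass`, `isCompatibleAt_compatClass`).
Local consistency near `x₀` (the only real work) is split as: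

* (B1) *transport of the consistency of `g` through the chart `φ₀`* (`exists_localConsistent_aux`):
  in the hub `U₀ = φ₀.source` the set `K'' = φ₀⁻¹ C` (`C` a small ball about `φ₀ x₀`) maps
  forward to `M` (an isomorphism `Hₙ(U₀ | K'') ≅ Hₙ(M | K)` by the excision theorem
  `relativeSingularHomology.isIso_map_of_interior_union_interior_holds`) and to `ℝⁿ`; restriction
  to points commutes with both push-forwards, and the restrictions `Hₙ(M | K) → Hₙ(M | x₀)`,
  `Hₙ(ℝⁿ | C) → Hₙ(ℝⁿ | p)` are isomorphisms (`isIso_restrictToPoint_of_starConvex_chart`,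
  `…_of_convex_chart`, Hatcher 2002, §3.3 p. 236); so the classes
  `ν_y = A⁰_y (B⁰_y)⁻¹ g_{φ₀ y}` read through the *fixed* chart `φ₀` are restrictions of one class;
* (B2) *change of chart* (`compatClass_eq_smul_aux`): for `y` near `x₀`,
  `μ_y = ε_{x₀} ν_y`. Through the hub `W = U₀ ∩ φ₀⁻¹ B(φ₀ y, r)` this is the statement that the
  transition map `τ = φ_y ∘ φ₀⁻¹` moves `g_{φ₀ y}` to `(ε_y ε_{x₀}) g_{φ_y y}`; by the linearisation
  theorem `HomologicalOrientation.localDegree_of_hasFDerivAt` (`…LocalDegreeLinearization`, Bredon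
  VI.7: a differentiable local homeomorphism acts on the local class by the sign of its Jacobian)
  `τ` moves `g_{φ₀ y}` as its derivative `L = tangentCoordChange I x₀ y y`
  (`hasFDerivWithinAt_tangentCoordChange`) does, i.e. by the sign of `det L`, and
  `o y = o x₀ ↔ 0 < det L⁻¹`
  (`SmoothOrientation.eventually_eq_iff`, the definition of a smooth orientation).

Everything is proved; this file introduces no definitions into the library API except the private
bookkeeping of the proof (none: all auxiliary objects are local), and no named facts.

## References

* G. E. Bredon, *Topology and Geometry*, GTM 139, Springer 1993, VI.7 Prop. 7.14, Thm. 7.15.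
  [Bredon1993]
* J. Milnor, J. Stasheff, *Characteristic Classes*, PUP 1974, Appendix A pp. 122–123.
  [MilnorStasheff1974]
* A. Hatcher, *Algebraic Topology*, CUP 2002, Thm. 2.20, §2.2 Ex. 7, §3.3 pp. 231–236.
  [HatcherAT2002]
-/

open scoped Manifold ContDiff Topology
open Set Function CategoryTheory Module Metric
open Literature.AlgebraicTopology.SingularHomology

noncomputable section

namespace Literature.Topology.FourManifolds

namespace SmoothOrientation

/-- Local notation: `𝔼 n` is the model Euclidean space `EuclideanSpace ℝ (Fin n)`. -/
local notation "𝔼 " n:arg => EuclideanSpace ℝ (Fin n)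

variable {n : ℕ} {M : Type} [TopologicalSpace M] [ChartedSpace (𝔼 n) M]

/-! ### Generalities: restriction commutes with push-forward; generators -/

/-- Restriction to a point commutes with the push-forward along a map of pairs: for `f : X → Y`
with `f(X ∖ K) ⊆ Y ∖ L`, `a ∈ K`, `b ∈ L` and `f(X ∖ a) ⊆ Y ∖ b`,
`r_b ∘ f_* = f_* ∘ r_a : Hₖ(X | K) → Hₖ(Y | b)` (both are the map of pairs
`(X, X ∖ K) → (Y, Y ∖ b)`;
Hatcher 2002, §3.3, naturality of `Hₙ(M | B) → Hₙ(M | y)`). [folklore] -/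
theorem map_comp_restrictToPoint {X Y : Type} [TopologicalSpace X] [TopologicalSpace Y]
    (f : C(X, Y)) {K : Set X} {L : Set Y} (hKL : MapsTo f Kᶜ Lᶜ) {a : X} {b : Y} (ha : a ∈ K)
    (hb : b ∈ L) (hab : MapsTo f ({a}ᶜ : Set X) {b}ᶜ) (k : ℕ) :
    relativeSingularHomology.map ℤ ℤ f hKL k ≫ restrictToPoint ℤ ℤ hb k =
      restrictToPoint ℤ ℤ ha k ≫ relativeSingularHomology.map ℤ ℤ f hab k := by
  rw [restrictToPoint, restrictLocal, restrictToPoint, restrictLocal,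
    ← relativeSingularHomology.map_comp, ← relativeSingularHomology.map_comp]
  rfl

/-- A signed generator is a generator: if `b` generates a `ℤ`-line then so does `u • b`, `u = ±1`.
[folklore] -/
theorem exists_linearEquiv_units_smul {N : Type*} [AddCommGroup N] [Module ℤ N] {b : N}
    (hb : ∃ e : N ≃ₗ[ℤ] ℤ, e b = 1) (u : ℤˣ) : ∃ e : N ≃ₗ[ℤ] ℤ, e ((u : ℤ) • b) = 1 := by
  obtain ⟨e, he⟩ := hb
  rcases Int.units_eq_one_or u with rfl | rfl
  · exact ⟨e, by rw [Units.val_one, one_zsmul, he]⟩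
  · exact ⟨e.trans (LinearEquiv.neg ℤ), by simp [he]⟩

/-! ### The two push-forwards are isomorphisms; the forced compatible class -/

variable [IsManifold (𝓡 n) 1 M] [T2Space M]

omit [IsManifold (𝓡 n) 1 M] [T2Space M] in
/-- The restricted chart `φₓ|U : Uₓ → ℝⁿ` is an open embedding (Mathlib's
`OpenPartialHomeomorph.isOpenEmbedding_restrict`). [folklore] -/
theorem isOpenEmbedding_chartRestrict (x : M) :
    Topology.IsOpenEmbedding (chartRestrict (n := n) x) :=
  (chartAt (𝔼 n) x).isOpenEmbedding_restrict

omit [IsManifold (𝓡 n) 1 M] [T2Space M] in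
/-- The restricted chart is injective. [folklore] -/
theorem chartRestrict_injective (x : M) : Function.Injective (chartRestrict (n := n) x) :=
  (isOpenEmbedding_chartRestrict x).injective

omit [IsManifold (𝓡 n) 1 M] in
/-- `pushIncl x k : Hₖ(Uₓ | x) ⟶ Hₖ(M | x)` is an isomorphism (excision at the open chart source;
Hatcher 2002, Thm. 2.20 / §3.3 p. 231). [cite: HatcherAT2002, §3.3 p. 231] -/
theorem isIso_pushIncl (x : M) (k : ℕ) : IsIso (pushIncl (n := n) x k) :=
  Literature.AlgebraicTopology.SingularHomology.localHomology.isIso_map_subsetIncl_of_isOpen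
    ℤ ℤ (chartAt (𝔼 n) x).open_source (mem_chart_source (𝔼 n) x) k

omit [IsManifold (𝓡 n) 1 M] [T2Space M] in
/-- `pushChart x k : Hₖ(Uₓ | x) ⟶ Hₖ(ℝⁿ | φₓ x)` is an isomorphism (the restricted chart is an
open embedding; Hatcher 2002, §3.3 p. 231). [cite: HatcherAT2002, §3.3 p. 231] -/
theorem isIso_pushChart (x : M) (k : ℕ) : IsIso (pushChart (n := n) x k) :=
  Literature.AlgebraicTopology.SingularHomology.localHomology.isIso_map_of_isOpenEmbedding_of_eq
    ℤ ℤ (chartRestrict x) (isOpenEmbedding_chartRestrict x) (chartSourcePt x) rfl k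

open Classical in
/-- The sign attached to a point by a smooth orientation: `+1` iff the preferred chart is
positively oriented there (`o x` is the standard orientation). [folklore] -/
abbrev signAt (o : SmoothOrientation (𝓡 n) M) (x : M) : ℤˣ :=
  if o x = euclideanOrientation n then 1 else -1

omit [T2Space M] in
/-- `signAt o x = 1 ↔ o x = euclideanOrientation n`. [folklore] -/
theorem signAt_eq_one_iff (o : SmoothOrientation (𝓡 n) M) (x : M) :
    signAt o x = 1 ↔ o x = euclideanOrientation n := by
  unfold signAt
  split_ifs with h
  · exact ⟨fun _ => h, fun _ => rfl⟩
  · exact ⟨fun h1 => absurd h1 (by decide), fun h' => absurd h' h⟩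

/-- **The forced compatible class** `μₓ = Aₓ Bₓ⁻¹ (εₓ • g_{φₓ x})` (Bredon 1993, VI.7: the class
of a positively oriented chart). [folklore] -/
abbrev compatClass (g : HomologicalOrientation ℤ (𝔼 n) n) (o : SmoothOrientation (𝓡 n) M)
    (x : M) : localHomology ℤ ℤ M x n :=
  haveI := isIso_pushChart (n := n) x n
  pushIncl x n (inv (pushChart x n) ((signAt o x : ℤ) • g.localClass (chartAt (𝔼 n) x x)))

omit [T2Space M] in
/-- The forced class is compatible with `o` at `x`. [folklore] -/
theorem isCompatibleAt_of_localClass_eq {g : HomologicalOrientation ℤ (𝔼 n) n}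
    {o : SmoothOrientation (𝓡 n) M} {μ : HomologicalOrientation ℤ M n} {x : M}
    (h : μ.localClass x = compatClass g o x) : IsCompatibleAt g o μ x := by
  haveI := isIso_pushChart (n := n) x n
  refine ⟨inv (pushChart x n) ((signAt o x : ℤ) • g.localClass (chartAt (𝔼 n) x x)), signAt o x,
    h.symm, ?_, signAt_eq_one_iff o x⟩
  rw [← ModuleCat.comp_apply, IsIso.inv_hom_id, ModuleCat.id_apply]

omit [T2Space M] in
/-- Compatibility forces the local class: any `μ` compatible with `o` at `x` has
`μₓ = Aₓ Bₓ⁻¹ (εₓ • g)` (both push-forwards are isomorphisms and the sign is determined by `o x`).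
[folklore] -/
theorem localClass_eq_of_isCompatibleAt {g : HomologicalOrientation ℤ (𝔼 n) n}
    {o : SmoothOrientation (𝓡 n) M} {μ : HomologicalOrientation ℤ M n} {x : M}
    (h : IsCompatibleAt g o μ x) : μ.localClass x = compatClass g o x := by
  haveI := isIso_pushChart (n := n) x n
  obtain ⟨c, ε, h₁, h₂, h₃⟩ := h
  have hε : ε = signAt o x := by
    rcases Int.units_eq_one_or ε with rfl | rfl <;>
      rcases Int.units_eq_one_or (signAt o x) with h' | h'
    · exact h'.symm
    · exact absurd ((signAt_eq_one_iff o x).2 (h₃.1 rfl)) (by rw [h']; decide)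
    · exact absurd (h₃.2 ((signAt_eq_one_iff o x).1 h')) (by decide)
    · exact h'.symm
  subst hε
  have hc : c = inv (pushChart x n) ((signAt o x : ℤ) • g.localClass (chartAt (𝔼 n) x x)) := by
    rw [← h₂, ← ModuleCat.comp_apply, IsIso.hom_inv_id, ModuleCat.id_apply]
  rw [← h₁, hc]

/-! ### (B1) Transport of the local consistency of `g` through a fixed chart -/

section Transport

variable (g : HomologicalOrientation ℤ (𝔼 n) n) (x₀ : M)

/-- The class at `y ∈ U₀` read through the *fixed* chart `φ₀ = chartAt x₀`:
`ν_y = A⁰_y (B⁰_y)⁻¹ g_{φ₀ y}`, where `A⁰_y : Hₙ(U₀ | y) ⥲ Hₙ(M | y)` and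
`B⁰_y : Hₙ(U₀ | y) ⥲ Hₙ(ℝⁿ | φ₀ y)` are the push-forwards along the inclusion and the chart.
[folklore] -/
abbrev fixedChartClass (y : M) (hy : y ∈ (chartAt (𝔼 n) x₀).source) : localHomology ℤ ℤ M y n :=
  haveI :=
    Literature.AlgebraicTopology.SingularHomology.localHomology.isIso_map_of_isOpenEmbedding_of_eq
      ℤ ℤ (chartRestrict x₀) (isOpenEmbedding_chartRestrict x₀) ⟨y, hy⟩ rfl n
  relativeSingularHomology.map ℤ ℤ (subsetIncl (chartAt (𝔼 n) x₀).source)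
    (mapsTo_compl_singleton_of_injective Subtype.val_injective (rfl : ((⟨y, hy⟩ :
      ↥(chartAt (𝔼 n) x₀).source) : M) = y)) n
    (inv (relativeSingularHomology.map ℤ ℤ (chartRestrict x₀)
      (mapsTo_compl_singleton_of_injective (chartRestrict_injective x₀)
        (rfl : chartRestrict x₀ ⟨y, hy⟩ = chartAt (𝔼 n) x₀ y)) n)
      (g.localClass (chartAt (𝔼 n) x₀ y)))

omit [IsManifold (𝓡 n) 1 M] in
/-- **(B1)** The classes `ν_y` read through a fixed chart are locally consistent on `M` near `x₀`:
there is a neighbourhood `K` of `x₀` inside `U₀` and a class `m ∈ Hₙ(M | K)` restricting to `ν_y`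
at every `y ∈ K` (transport of the local consistency of `g` on a small chart ball through the hub
`U₀`, by excision `Hₙ(U₀ | K'') ≅ Hₙ(M | K)` and the isomorphisms `Hₙ(M | K) ≅ Hₙ(M | x₀)`,
`Hₙ(ℝⁿ | C) ≅ Hₙ(ℝⁿ | p)` of Hatcher 2002, §3.3 p. 236). [cite: HatcherAT2002, §3.3 p. 236] -/
theorem exists_restrictToPoint_eq_fixedChartClass :
    ∃ K : Set M, K ∈ 𝓝 x₀ ∧ ∃ hKU : K ⊆ (chartAt (𝔼 n) x₀).source,
      ∃ m : localHomologyOfSet ℤ ℤ M K n, ∀ (y : M) (hy : y ∈ K),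
        restrictToPoint ℤ ℤ hy n m = fixedChartClass g x₀ y (hKU hy) := by
  set φ₀ := chartAt (𝔼 n) x₀ with hφ₀
  set p₀ : 𝔼 n := φ₀ x₀ with hp₀
  have hx₀ : x₀ ∈ φ₀.source := mem_chart_source (𝔼 n) x₀
  -- local consistency of `g` at `p₀` and a small closed ball in the target
  obtain ⟨Kg, hKg, gK, hgK⟩ := g.locallyConsistent p₀
  have hW : φ₀.target ∩ Kg ∈ 𝓝 p₀ := Filter.inter_mem (chart_target_mem_nhds (𝔼 n) x₀) hKg
  obtain ⟨ρ, hρ, hρW⟩ := nhds_basis_closedBall.mem_iff.1 hW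
  have hρt : closedBall p₀ ρ ⊆ φ₀.target := hρW.trans inter_subset_left
  have hρK : closedBall p₀ ρ ⊆ Kg := hρW.trans inter_subset_right
  -- the convex piece `C` and the neighbourhood `K = φ₀⁻¹ C`
  set r : ℝ := ρ / 4 with hr
  have hr0 : 0 < r := by positivity
  set C : Set (𝔼 n) := ball p₀ r with hC
  have hCρ : C ⊆ ball p₀ ρ := ball_subset_ball (by rw [hr]; linarith)
  have hCK : C ⊆ Kg := (hCρ.trans ball_subset_closedBall).trans hρK
  have hp₀C : p₀ ∈ C := mem_ball_self hr0
  set K : Set M := φ₀.source ∩ φ₀ ⁻¹' C with hK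
  have hKU : K ⊆ φ₀.source := inter_subset_left
  have hKo : IsOpen K := φ₀.isOpen_inter_preimage isOpen_ball
  have hx₀K : x₀ ∈ K := ⟨hx₀, hp₀C⟩
  have hKn : K ∈ 𝓝 x₀ := hKo.mem_nhds hx₀K
  -- the restriction of `g_{Kg}` to `C`
  set gC : localHomologyOfSet ℤ ℤ (𝔼 n) C n := restrictLocal ℤ ℤ hCK n gK with hgC
  have hgC' : ∀ (p : 𝔼 n) (hp : p ∈ C), restrictToPoint ℤ ℤ hp n gC = g.localClass p :=
    fun p hp => by rw [hgC, restrictToPoint_restrictLocal_apply, hgK p (hCK hp)]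
  -- isomorphisms: restrictions on `M` at `x₀` and on `ℝⁿ` at points of `C`
  haveI hrM : IsIso (restrictToPoint ℤ ℤ hx₀K n) :=
    isIso_restrictToPoint_of_starConvex_chart ℤ ℤ φ₀ hx₀ hρ hρt
      ((convex_ball p₀ r).starConvex hp₀C) hp₀C hCρ hK hx₀K n
  have hrE : ∀ (p : 𝔼 n) (hp : p ∈ C), IsIso (restrictToPoint ℤ ℤ hp n) := fun p hp => by
    refine isIso_restrictToPoint_of_convex_chart ℤ ℤ (OpenPartialHomeomorph.refl (𝔼 n))
      (p := p₀) (r := r) hr0 (subset_univ _) (convex_ball p₀ r) ball_subset_closedBall ?_ hp n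
    rw [OpenPartialHomeomorph.refl_source, Set.univ_inter]
    rfl
  -- the hub `U₀` with `K'' = φ₀|⁻¹ C`, the set-level push-forwards `P`, `Q`
  set U : Set M := φ₀.source with hU
  set K'' : Set ↥U := Subtype.val ⁻¹' K with hK''
  have hx₀'' : (⟨x₀, hx₀⟩ : ↥U) ∈ K'' := hx₀K
  have hPm : MapsTo (subsetIncl U) K''ᶜ Kᶜ := fun z hz hz' => hz hz'
  have hQm : MapsTo (chartRestrict x₀) K''ᶜ Cᶜ := fun z hz hz' => hz ⟨z.2, hz'⟩
  -- `P` is an isomorphism by excision (`closure K ⊆ U`)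
  have hPiso : IsIso (relativeSingularHomology.map ℤ ℤ (subsetIncl U) hPm n) := by
    have hcl : closure K ⊆ U := by
      have hD : IsClosed (φ₀.source ∩ φ₀ ⁻¹' closedBall p₀ r) := by
        have hrt : closedBall p₀ r ⊆ φ₀.target :=
          (closedBall_subset_closedBall (by rw [hr]; linarith)).trans hρt
        rw [← φ₀.symm_image_eq_source_inter_preimage hrt]
        exact ((isCompact_closedBall p₀ r).image_of_continuousOn
          (φ₀.continuousOn_symm.mono hrt)).isClosed
      exact (closure_minimal (t := φ₀.source ∩ φ₀ ⁻¹' closedBall p₀ r)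
        (fun y hy => ⟨hy.1, ball_subset_closedBall hy.2⟩) hD).trans inter_subset_left
    have hcov : interior Kᶜ ∪ interior U = univ := by
      rw [φ₀.open_source.interior_eq]
      refine eq_univ_of_forall fun y => ?_
      by_cases hy : y ∈ U
      · exact Or.inr hy
      · exact Or.inl (interior_maximal (t := (closure K)ᶜ) (compl_subset_compl.2 subset_closure)
          isClosed_closure.isOpen_compl (fun h => hy (hcl h)))
    exact relativeSingularHomology.isIso_map_of_interior_union_interior_holds ℤ ℤ M Kᶜ U hcov n
  -- maps of pairs at `x₀` and the isomorphisms `A⁰_{x₀}`, `B⁰_{x₀}`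
  set x₀' : ↥U := ⟨x₀, hx₀⟩ with hx₀'
  have hx₀'' : x₀' ∈ K'' := hx₀K
  have mAx : MapsTo (subsetIncl U) ({x₀'}ᶜ : Set ↥U) {x₀}ᶜ :=
    mapsTo_compl_singleton_of_injective Subtype.val_injective rfl
  have mBx : MapsTo (chartRestrict x₀) ({x₀'}ᶜ : Set ↥U) {p₀}ᶜ :=
    mapsTo_compl_singleton_of_injective (chartRestrict_injective x₀) rfl
  haveI iAx : IsIso (relativeSingularHomology.map ℤ ℤ (subsetIncl U) mAx n) :=
    Literature.AlgebraicTopology.SingularHomology.localHomology.isIso_map_subsetIncl_of_isOpen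
      ℤ ℤ φ₀.open_source hx₀ n
  haveI iBx : IsIso (relativeSingularHomology.map ℤ ℤ (chartRestrict x₀) mBx n) :=
    Literature.AlgebraicTopology.SingularHomology.localHomology.isIso_map_of_isOpenEmbedding_of_eq
      ℤ ℤ (chartRestrict x₀) (isOpenEmbedding_chartRestrict x₀) x₀' rfl n
  haveI := hPiso
  -- `r''_{x₀}` is an isomorphism: `P ≫ r_{x₀} = r''_{x₀} ≫ A⁰_{x₀}`
  have hsq₁ := map_comp_restrictToPoint (subsetIncl U) hPm hx₀'' hx₀K mAx n
  haveI hr'' : IsIso (restrictToPoint ℤ ℤ hx₀'' n) := by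
    haveI : IsIso (restrictToPoint ℤ ℤ hx₀'' n ≫
        relativeSingularHomology.map ℤ ℤ (subsetIncl U) mAx n) := by
      rw [← hsq₁]; exact IsIso.comp_isIso
    exact IsIso.of_isIso_comp_right (restrictToPoint ℤ ℤ hx₀'' n)
      (relativeSingularHomology.map ℤ ℤ (subsetIncl U) mAx n)
  -- the class `c` on the hub with `r''_{x₀} c = (B⁰_{x₀})⁻¹ g_{p₀}`
  set d : localHomology ℤ ℤ ↥U x₀' n :=
    inv (relativeSingularHomology.map ℤ ℤ (chartRestrict x₀) mBx n) (g.localClass p₀) with hd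
  clear_value d
  set c : localHomologyOfSet ℤ ℤ ↥U K'' n := inv (restrictToPoint ℤ ℤ hx₀'' n) d with hc
  clear_value c
  have hcd : restrictToPoint ℤ ℤ hx₀'' n c = d := by
    rw [hc, ← ModuleCat.comp_apply, IsIso.inv_hom_id, ModuleCat.id_apply]
  have hBd : relativeSingularHomology.map ℤ ℤ (chartRestrict x₀) mBx n d = g.localClass p₀ := by
    rw [hd, ← ModuleCat.comp_apply, IsIso.inv_hom_id, ModuleCat.id_apply]
  -- `Q c = gC`, tested at `p₀` where restriction is injective
  have hQc : relativeSingularHomology.map ℤ ℤ (chartRestrict x₀) hQm n c = gC := by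
    haveI := hrE p₀ hp₀C
    apply (ModuleCat.mono_iff_injective (restrictToPoint ℤ ℤ hp₀C n)).1 inferInstance
    have hsq₂ := map_comp_restrictToPoint (chartRestrict x₀) hQm hx₀'' hp₀C mBx n
    have e₂ : restrictToPoint ℤ ℤ hp₀C n
        (relativeSingularHomology.map ℤ ℤ (chartRestrict x₀) hQm n c) =
        relativeSingularHomology.map ℤ ℤ (chartRestrict x₀) mBx n
          (restrictToPoint ℤ ℤ hx₀'' n c) := by
      rw [← ModuleCat.comp_apply, hsq₂, ModuleCat.comp_apply]
    change restrictToPoint ℤ ℤ hp₀C n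
        (relativeSingularHomology.map ℤ ℤ (chartRestrict x₀) hQm n c) =
      restrictToPoint ℤ ℤ hp₀C n gC
    rw [e₂, hcd, hBd, hgC' p₀ hp₀C]
  -- the class on `M` and its restrictions
  refine ⟨K, hKn, hKU, relativeSingularHomology.map ℤ ℤ (subsetIncl U) hPm n c, fun y hy => ?_⟩
  have hyU : y ∈ U := hKU hy
  set y' : ↥U := ⟨y, hyU⟩ with hy'
  have hy'' : y' ∈ K'' := hy
  have hpy : φ₀ y ∈ C := hy.2
  have mAy : MapsTo (subsetIncl U) ({y'}ᶜ : Set ↥U) {y}ᶜ :=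
    mapsTo_compl_singleton_of_injective Subtype.val_injective rfl
  have mBy : MapsTo (chartRestrict x₀) ({y'}ᶜ : Set ↥U) {φ₀ y}ᶜ :=
    mapsTo_compl_singleton_of_injective (chartRestrict_injective x₀) rfl
  haveI iBy : IsIso (relativeSingularHomology.map ℤ ℤ (chartRestrict x₀) mBy n) :=
    Literature.AlgebraicTopology.SingularHomology.localHomology.isIso_map_of_isOpenEmbedding_of_eq
      ℤ ℤ (chartRestrict x₀) (isOpenEmbedding_chartRestrict x₀) y' rfl n
  have hsq₃ := map_comp_restrictToPoint (subsetIncl U) hPm hy'' hy mAy n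
  have hsq₄ := map_comp_restrictToPoint (chartRestrict x₀) hQm hy'' hpy mBy n
  have e₃ : restrictToPoint ℤ ℤ hy n (relativeSingularHomology.map ℤ ℤ (subsetIncl U) hPm n c) =
      relativeSingularHomology.map ℤ ℤ (subsetIncl U) mAy n (restrictToPoint ℤ ℤ hy'' n c) := by
    rw [← ModuleCat.comp_apply, hsq₃, ModuleCat.comp_apply]
  have e₄ : g.localClass (φ₀ y) =
      relativeSingularHomology.map ℤ ℤ (chartRestrict x₀) mBy n (restrictToPoint ℤ ℤ hy'' n c) := by
    rw [← hgC' (φ₀ y) hpy, ← hQc, ← ModuleCat.comp_apply, hsq₄, ModuleCat.comp_apply]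
  have e₅ : inv (relativeSingularHomology.map ℤ ℤ (chartRestrict x₀) mBy n) (g.localClass (φ₀ y)) =
      restrictToPoint ℤ ℤ hy'' n c := by
    rw [e₄, ← ModuleCat.comp_apply, IsIso.hom_inv_id, ModuleCat.id_apply]
  rw [e₃, ← e₅]
  rfl

end Transport

/-! ### (B2) Change of chart: the transition map acts by the sign of its Jacobian -/

section ChangeOfChart

variable (g : HomologicalOrientation ℤ (𝔼 n) n) (o : SmoothOrientation (𝓡 n) M)

omit [T2Space M] in
/-- Signs of `o` at two points whose orientations are compared by `s`: if `s = 1 ↔ o y = o x₀`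
then `ε_y s = ε_{x₀}` (the model space has exactly the two orientations `± e`). [folklore] -/
theorem signAt_mul_eq_signAt {x₀ y : M} {s : ℤˣ} (h : s = 1 ↔ o y = o x₀) :
    signAt o y * s = signAt o x₀ := by
  have two := fun a b : Orientation ℝ (𝔼 n) (Fin (finrank ℝ (𝔼 n))) =>
    Orientation.eq_or_eq_neg a b (by simp)
  have hne : ∀ a : Orientation ℝ (𝔼 n) (Fin (finrank ℝ (𝔼 n))), a ≠ -a := fun a =>
    Module.Ray.ne_neg_self a
  rcases Int.units_eq_one_or s with rfl | rfl
  · have hy : o y = o x₀ := h.1 rfl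
    rw [mul_one]
    unfold signAt
    rw [hy]
  · have hy : o y ≠ o x₀ := fun e => absurd (h.2 e) (by decide)
    have hy' : o y = -o x₀ := (two (o y) (o x₀)).resolve_left hy
    rw [mul_neg, mul_one]
    unfold signAt
    by_cases hx : o x₀ = euclideanOrientation n
    · have hny : ¬ o y = euclideanOrientation n := by
        rw [hy', hx]
        exact fun e => hne _ e.symm
      rw [if_pos hx, if_neg hny]
      exact neg_neg 1
    · have hx' : o x₀ = -euclideanOrientation n :=
        (two (o x₀) (euclideanOrientation n)).resolve_left hx
      have hye : o y = euclideanOrientation n := by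
        rw [hy', hx']
        exact neg_neg (euclideanOrientation n)
      rw [if_neg hx, if_pos hye]

omit [T2Space M] in
/-- The derivative of the chart transition `φ_y ∘ φ₀⁻¹` at `φ₀ y` is `tangentCoordChange I x₀ y y`
(Mathlib's `hasFDerivWithinAt_tangentCoordChange`, for the boundaryless model `𝓡 n`). [folklore] -/
theorem hasFDerivAt_transition {x₀ y : M} (hy : y ∈ (chartAt (𝔼 n) x₀).source) :
    HasFDerivAt ((chartAt (𝔼 n) x₀).symm.trans (chartAt (𝔼 n) y))
      (tangentCoordChange (𝓡 n) x₀ y y) (chartAt (𝔼 n) x₀ y) := by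
  have h : y ∈ (extChartAt (𝓡 n) x₀).source ∩ (extChartAt (𝓡 n) y).source := by
    simp only [extChartAt_source]
    exact ⟨hy, mem_chart_source _ y⟩
  have hd := hasFDerivWithinAt_tangentCoordChange (I := 𝓡 n) h
  rw [ModelWithCorners.Boundaryless.range_eq_univ, hasFDerivWithinAt_univ] at hd
  have e₁ : (extChartAt (𝓡 n) y) ∘ (extChartAt (𝓡 n) x₀).symm =
      ((chartAt (𝔼 n) x₀).symm.trans (chartAt (𝔼 n) y)) := by
    funext v
    simp only [extChartAt_coe, extChartAt_coe_symm, modelWithCornersSelf_coe,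
      modelWithCornersSelf_coe_symm, Function.comp_apply, id_eq, OpenPartialHomeomorph.coe_trans]
  have e₂ : extChartAt (𝓡 n) x₀ y = chartAt (𝔼 n) x₀ y := by
    simp only [extChartAt_coe, modelWithCornersSelf_coe, Function.comp_apply, id_eq]
  rwa [e₁, e₂] at hd

omit [T2Space M] in
/-- The two transition derivatives at `y` are mutually inverse:
`tangentCoordChange I x₀ y y ∘ tangentCoordChange I y x₀ y = id`. [folklore] -/
theorem tangentCoordChange_comp_apply {x₀ y : M} (hy : y ∈ (chartAt (𝔼 n) x₀).source)
    (v : 𝔼 n) :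
    tangentCoordChange (𝓡 n) x₀ y y (tangentCoordChange (𝓡 n) y x₀ y v) = v := by
  have hy' : y ∈ (extChartAt (𝓡 n) y).source := by
    rw [extChartAt_source]; exact mem_chart_source _ y
  have hy₀ : y ∈ (extChartAt (𝓡 n) x₀).source := by rwa [extChartAt_source]
  rw [tangentCoordChange_comp ⟨⟨hy', hy₀⟩, hy'⟩, tangentCoordChange_self hy']

omit [T2Space M] in
/-- The determinants of the two transition derivatives at `y` multiply to `1`; in particular the
one is non-zero and both have the same sign. [folklore] -/
theorem det_tangentCoordChange_mul {x₀ y : M} (hy : y ∈ (chartAt (𝔼 n) x₀).source) :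
    LinearMap.det ((tangentCoordChange (𝓡 n) x₀ y y : 𝔼 n →L[ℝ] 𝔼 n) : 𝔼 n →ₗ[ℝ] 𝔼 n) *
      LinearMap.det ((tangentCoordChange (𝓡 n) y x₀ y : 𝔼 n →L[ℝ] 𝔼 n) : 𝔼 n →ₗ[ℝ] 𝔼 n) = 1 := by
  rw [← LinearMap.det_comp]
  have : ((tangentCoordChange (𝓡 n) x₀ y y : 𝔼 n →L[ℝ] 𝔼 n) : 𝔼 n →ₗ[ℝ] 𝔼 n).comp
      ((tangentCoordChange (𝓡 n) y x₀ y : 𝔼 n →L[ℝ] 𝔼 n) : 𝔼 n →ₗ[ℝ] 𝔼 n) = LinearMap.id :=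
    LinearMap.ext fun v => tangentCoordChange_comp_apply hy v
  rw [this, LinearMap.det_id]

/-- **(B2) Change of chart.** For `y` in the source of `φ₀ = chartAt x₀` at which the defining
local-constancy relation of `o` holds (`o y = o x₀ ↔` the transition `φ₀ ∘ φ_y⁻¹` has positive
Jacobian at `y`), the forced class at `y` is `ε_{x₀}` times the class read through the fixed chart:
`μ_y = ε_{x₀} • ν_y`. The transition `τ = φ_y ∘ φ₀⁻¹` acts on the local orientation class as its
derivative, i.e. by the sign of the Jacobian (`HomologicalOrientation.localDegree_of_hasFDerivAt`,
Bredon 1993, VI.7; Hatcher 2002, §2.2 Ex. 7).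
[cite: Bredon1993, VI.7] -/
theorem compatClass_eq_smul_fixedChartClass {x₀ y : M} (hyU : y ∈ (chartAt (𝔼 n) x₀).source)
    (hdet : o y = o x₀ ↔ 0 < LinearMap.det
      ((tangentCoordChange (𝓡 n) y x₀ y : 𝔼 n →L[ℝ] 𝔼 n) : 𝔼 n →ₗ[ℝ] 𝔼 n)) :
    compatClass g o y = (signAt o x₀ : ℤ) • fixedChartClass g x₀ y hyU := by
  set φ₀ := chartAt (𝔼 n) x₀ with hφ₀
  set φ := chartAt (𝔼 n) y with hφ
  have hyV : y ∈ φ.source := mem_chart_source (𝔼 n) y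
  set τ := φ₀.symm.trans φ with hτ
  set p : 𝔼 n := φ₀ y with hp
  set q : 𝔼 n := φ y with hq
  have hpτ : p ∈ τ.source := by
    rw [hτ, OpenPartialHomeomorph.trans_source, OpenPartialHomeomorph.symm_source]
    exact ⟨φ₀.map_source hyU, by
      rw [mem_preimage, φ₀.left_inv hyU]; exact hyV⟩
  have hτp : τ p = q := by
    change φ (φ₀.symm (φ₀ y)) = φ y
    rw [φ₀.left_inv hyU]
  -- a ball inside the source of the transition map
  obtain ⟨r, hr, hball⟩ := Metric.isOpen_iff.1 τ.open_source p hpτ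
  set f : 𝔼 n → 𝔼 n := ⇑τ with hf
  have hfc : ContinuousOn f (ball p r) := τ.continuousOn.mono hball
  have hfi : InjOn f (ball p r) := τ.injOn.mono hball
  -- the derivative and its sign
  set L : 𝔼 n →L[ℝ] 𝔼 n := tangentCoordChange (𝓡 n) x₀ y y with hL
  set L' : 𝔼 n →L[ℝ] 𝔼 n := tangentCoordChange (𝓡 n) y x₀ y with hL'
  have hd : HasFDerivAt f L p := hasFDerivAt_transition hyU
  have hL'L : ∀ v, L' (L v) = v := fun v => by
    have hy' : y ∈ (extChartAt (𝓡 n) x₀).source := by rwa [extChartAt_source]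
    have hy₀ : y ∈ (extChartAt (𝓡 n) y).source := by
      rw [extChartAt_source]; exact hyV
    rw [hL, hL', tangentCoordChange_comp ⟨⟨hy', hy₀⟩, hy'⟩, tangentCoordChange_self hy']
  have hLinj : Function.Injective L := Function.LeftInverse.injective hL'L
  have hdetmul := det_tangentCoordChange_mul (n := n) hyU
  have hdet0 : LinearMap.det (L : 𝔼 n →ₗ[ℝ] 𝔼 n) ≠ 0 := fun h => by
    rw [hL] at h; rw [h, zero_mul] at hdetmul; exact zero_ne_one hdetmul
  have hsign : (0 < LinearMap.det (L : 𝔼 n →ₗ[ℝ] 𝔼 n)) ↔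
      0 < LinearMap.det (L' : 𝔼 n →ₗ[ℝ] 𝔼 n) := by
    have hpos : 0 < LinearMap.det (L : 𝔼 n →ₗ[ℝ] 𝔼 n) * LinearMap.det (L' : 𝔼 n →ₗ[ℝ] 𝔼 n) := by
      rw [hL, hL', hdetmul]; exact one_pos
    rcases mul_pos_iff.1 hpos with ⟨h1, h2⟩ | ⟨h1, h2⟩
    · exact ⟨fun _ => h2, fun _ => h1⟩
    · exact ⟨fun h => absurd h1 (not_lt.2 h.le), fun h => absurd h2 (not_lt.2 h.le)⟩
  -- the sign `s` of the Jacobian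
  set s : ℤˣ := if 0 < LinearMap.det (L : 𝔼 n →ₗ[ℝ] 𝔼 n) then 1 else -1 with hs
  have hs1 : s = 1 ↔ 0 < LinearMap.det (L : 𝔼 n →ₗ[ℝ] 𝔼 n) := by
    rw [hs]
    split_ifs with h
    · exact ⟨fun _ => h, fun _ => rfl⟩
    · exact ⟨fun h1 => absurd h1 (by decide), fun h' => absurd h' h⟩
  have hsg : (if 0 < LinearMap.det (L : 𝔼 n →ₗ[ℝ] 𝔼 n) then g.localClass q
      else -g.localClass q) = (s : ℤ) • g.localClass q := by
    rw [hs]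
    split_ifs
    · rw [Units.val_one, one_zsmul]
    · rw [Units.val_neg, Units.val_one, neg_one_zsmul]
  -- `ε_y s = ε_{x₀}`
  have hεs : signAt o y * s = signAt o x₀ :=
    signAt_mul_eq_signAt o (hs1.trans (hsign.trans hdet.symm))
  -- the hub `W = U₀ ∩ φ₀⁻¹ B(p, r)` and its maps
  set W : Set M := φ₀.source ∩ φ₀ ⁻¹' ball p r with hW
  have hWo : IsOpen W := φ₀.isOpen_inter_preimage isOpen_ball
  have hyW : y ∈ W := ⟨hyU, mem_ball_self hr⟩
  have hWU : W ⊆ φ₀.source := inter_subset_left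
  have hWV : W ⊆ φ.source := fun w hw => by
    have h := hball hw.2
    rw [hτ, OpenPartialHomeomorph.trans_source, OpenPartialHomeomorph.symm_source] at h
    have h2 := h.2
    rwa [mem_preimage, φ₀.left_inv hw.1] at h2
  set w₀ : ↥W := ⟨y, hyW⟩ with hw₀
  let jM : C(↥W, M) := subsetIncl W
  let j₀ : C(↥W, ↥φ₀.source) := subsetInclusion hWU
  let jV : C(↥W, ↥φ.source) := subsetInclusion hWV
  let κ : C(↥W, ↥(ball p r)) :=
    ⟨fun w => ⟨φ₀ w, w.2.2⟩, (φ₀.continuousOn.comp_continuous continuous_subtype_val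
      (fun w => w.2.1)).subtype_mk _⟩
  have hκinj : Function.Injective κ := fun a b h => Subtype.ext
    (φ₀.injOn a.2.1 b.2.1 (congrArg (fun z : ↥(ball p r) => (z : 𝔼 n)) h))
  have hx' : ((κ w₀ : ↥(ball p r)) : 𝔼 n) = p := rfl
  -- relations between the maps
  have R1 : (subsetIncl φ₀.source).comp j₀ = jM := rfl
  have R2 : (subsetIncl φ.source).comp jV = jM := rfl
  have R3 : (chartRestrict x₀).comp j₀ = (subsetIncl (ball p r)).comp κ := rfl
  let fB : C(↥(ball p r), 𝔼 n) := ⟨fun v => f v, hfc.restrict⟩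
  have R4 : (chartRestrict y).comp jV = fB.comp κ := by
    ext w : 1
    change φ w.1 = τ (φ₀ w.1)
    change φ w.1 = φ (φ₀.symm (φ₀ w.1))
    rw [φ₀.left_inv w.2.1]
  -- `MapsTo` bookkeeping
  have mjM : MapsTo jM ({w₀}ᶜ : Set ↥W) {y}ᶜ :=
    mapsTo_compl_singleton_of_injective Subtype.val_injective rfl
  have mj₀ : MapsTo j₀ ({w₀}ᶜ : Set ↥W) {(⟨y, hyU⟩ : ↥φ₀.source)}ᶜ :=
    mapsTo_compl_singleton_of_injective (inclusion_injective hWU) rfl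
  have mjV : MapsTo jV ({w₀}ᶜ : Set ↥W) {chartSourcePt y}ᶜ :=
    mapsTo_compl_singleton_of_injective (inclusion_injective hWV) rfl
  have mκ : MapsTo κ ({w₀}ᶜ : Set ↥W) {κ w₀}ᶜ := mapsTo_compl_singleton_of_injective hκinj rfl
  have mA0 : MapsTo (subsetIncl φ₀.source) ({(⟨y, hyU⟩ : ↥φ₀.source)}ᶜ : Set ↥φ₀.source) {y}ᶜ :=
    mapsTo_compl_singleton_of_injective Subtype.val_injective rfl
  have mB0 : MapsTo (chartRestrict x₀) ({(⟨y, hyU⟩ : ↥φ₀.source)}ᶜ : Set ↥φ₀.source) {p}ᶜ :=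
    mapsTo_compl_singleton_of_injective (chartRestrict_injective x₀) rfl
  have mι : MapsTo (subsetIncl (ball p r)) ({κ w₀}ᶜ : Set ↥(ball p r)) {p}ᶜ :=
    mapsTo_compl_singleton_of_injective Subtype.val_injective hx'
  have m₁ : MapsTo fB ({κ w₀}ᶜ : Set ↥(ball p r)) {q}ᶜ :=
    mapsTo_compl_singleton_of_injective (fun a b h => Subtype.ext (hfi a.2 b.2 h)) hτp
  -- isomorphisms at the point `y`
  haveI iA : IsIso (relativeSingularHomology.map ℤ ℤ (subsetIncl φ₀.source) mA0 n) :=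
    Literature.AlgebraicTopology.SingularHomology.localHomology.isIso_map_subsetIncl_of_isOpen
      ℤ ℤ φ₀.open_source hyU n
  haveI iB : IsIso (relativeSingularHomology.map ℤ ℤ (chartRestrict x₀) mB0 n) :=
    Literature.AlgebraicTopology.SingularHomology.localHomology.isIso_map_of_isOpenEmbedding_of_eq
      ℤ ℤ (chartRestrict x₀) (isOpenEmbedding_chartRestrict x₀) ⟨y, hyU⟩ rfl n
  haveI iM : IsIso (relativeSingularHomology.map ℤ ℤ jM mjM n) :=
    Literature.AlgebraicTopology.SingularHomology.localHomology.isIso_map_subsetIncl_of_isOpen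
      ℤ ℤ hWo hyW n
  haveI ij₀ : IsIso (relativeSingularHomology.map ℤ ℤ j₀ mj₀ n) := by
    have w : relativeSingularHomology.map ℤ ℤ j₀ mj₀ n ≫
        relativeSingularHomology.map ℤ ℤ (subsetIncl φ₀.source) mA0 n =
        relativeSingularHomology.map ℤ ℤ jM mjM n :=
      (relativeSingularHomology.map_comp ℤ ℤ j₀ (subsetIncl φ₀.source) mj₀ mA0 n).symm.trans
        (relativeSingularHomology.map.congr_simp ℤ ℤ _ _ R1 _ n)
    haveI : IsIso (relativeSingularHomology.map ℤ ℤ j₀ mj₀ n ≫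
        relativeSingularHomology.map ℤ ℤ (subsetIncl φ₀.source) mA0 n) := by
      rw [w]; exact iM
    exact IsIso.of_isIso_comp_right (relativeSingularHomology.map ℤ ℤ j₀ mj₀ n)
      (relativeSingularHomology.map ℤ ℤ (subsetIncl φ₀.source) mA0 n)
  haveI iBy := isIso_pushChart (n := n) y n
  -- the classes `d = (B⁰_y)⁻¹ g_p`, `e = (j₀)_*⁻¹ d`, `c = κ_* e`
  set d := inv (relativeSingularHomology.map ℤ ℤ (chartRestrict x₀) mB0 n) (g.localClass p)
    with hd'
  clear_value d
  set e := inv (relativeSingularHomology.map ℤ ℤ j₀ mj₀ n) d with he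
  clear_value e
  set c := relativeSingularHomology.map ℤ ℤ κ mκ n e with hc'
  clear_value c
  have hj₀e : relativeSingularHomology.map ℤ ℤ j₀ mj₀ n e = d := by
    rw [he, ← ModuleCat.comp_apply, IsIso.inv_hom_id, ModuleCat.id_apply]
  have hBd : relativeSingularHomology.map ℤ ℤ (chartRestrict x₀) mB0 n d = g.localClass p := by
    rw [hd', ← ModuleCat.comp_apply, IsIso.inv_hom_id, ModuleCat.id_apply]
  have hc : relativeSingularHomology.map ℤ ℤ (subsetIncl (ball p r)) mι n c = g.localClass p := by
    rw [hc', ← ModuleCat.comp_apply,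
      ← relativeSingularHomology.map_comp ℤ ℤ κ (subsetIncl (ball p r)) mκ mι n,
      ← relativeSingularHomology.map.congr_simp ℤ ℤ _ _ R3 (mB0.comp mj₀) n,
      relativeSingularHomology.map_comp ℤ ℤ j₀ (chartRestrict x₀) mj₀ mB0 n, ModuleCat.comp_apply,
      hj₀e, hBd]
  -- the local degree theorem: `(f|B)_* c = s • g_q`
  have hc2 : c = (Literature.AlgebraicTopology.SingularHomology.localHomology.openSubsetIso ℤ ℤ
      isOpen_ball (κ w₀).2 n).inv (g.localClass p) := by
    have hh : (Literature.AlgebraicTopology.SingularHomology.localHomology.openSubsetIso ℤ ℤ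
        isOpen_ball (κ w₀).2 n).hom c = g.localClass p := hc
    rw [← hh, ← ModuleCat.comp_apply, Iso.hom_inv_id, ModuleCat.id_apply]
  have hD : relativeSingularHomology.map ℤ ℤ fB m₁ n c = (s : ℤ) • g.localClass q := by
    rw [← hsg, hc2]
    exact HomologicalOrientation.localDegree_of_hasFDerivAt g f isOpen_ball (κ w₀).2 hfc hd hdet0
      hτp m₁
  -- `B_y ((j_V)_* e) = s • g_q`
  have hBy : pushChart y n (relativeSingularHomology.map ℤ ℤ jV mjV n e) =
      (s : ℤ) • g.localClass q := by
    rw [← hD, hc', ← ModuleCat.comp_apply, ← ModuleCat.comp_apply]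
    have hm : relativeSingularHomology.map ℤ ℤ jV mjV n ≫ pushChart y n =
        relativeSingularHomology.map ℤ ℤ κ mκ n ≫
          relativeSingularHomology.map ℤ ℤ fB m₁ n := by
      change relativeSingularHomology.map ℤ ℤ jV mjV n ≫
        Literature.AlgebraicTopology.SingularHomology.localHomology.push _ _ _ _ n = _
      rw [Literature.AlgebraicTopology.SingularHomology.localHomology.push_def,
        ← relativeSingularHomology.map_comp, ← relativeSingularHomology.map_comp]
      exact relativeSingularHomology.map.congr_simp ℤ ℤ _ _ R4 _ n
    rw [hm]
  -- `B_y⁻¹ g_q = s • (j_V)_* e`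
  have hinvB : inv (pushChart y n) (g.localClass q) =
      (s : ℤ) • relativeSingularHomology.map ℤ ℤ jV mjV n e := by
    have e1 : relativeSingularHomology.map ℤ ℤ jV mjV n e =
        inv (pushChart y n) ((s : ℤ) • g.localClass q) := by
      rw [← hBy, ← ModuleCat.comp_apply, IsIso.hom_inv_id, ModuleCat.id_apply]
    rw [e1, map_zsmul, smul_smul, ← Units.val_mul, Int.units_mul_self, Units.val_one, one_zsmul]
  -- `μ_y = (ε_y s) • (j_M)_* e`
  have hμ : compatClass g o y =
      ((signAt o y * s : ℤˣ) : ℤ) • relativeSingularHomology.map ℤ ℤ jM mjM n e := by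
    change pushIncl y n (inv (pushChart y n) ((signAt o y : ℤ) • g.localClass q)) = _
    rw [map_zsmul, hinvB, smul_smul, map_zsmul, Units.val_mul, ← ModuleCat.comp_apply]
    have hm : relativeSingularHomology.map ℤ ℤ jV mjV n ≫ pushIncl y n =
        relativeSingularHomology.map ℤ ℤ jM mjM n := by
      change relativeSingularHomology.map ℤ ℤ jV mjV n ≫
        Literature.AlgebraicTopology.SingularHomology.localHomology.push _ _ _ _ n = _
      rw [Literature.AlgebraicTopology.SingularHomology.localHomology.push_def,
        ← relativeSingularHomology.map_comp]
      exact relativeSingularHomology.map.congr_simp ℤ ℤ _ _ R2 _ n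
    rw [hm]
  -- `ν_y = (j_M)_* e`
  have hν : fixedChartClass g x₀ y hyU = relativeSingularHomology.map ℤ ℤ jM mjM n e := by
    change relativeSingularHomology.map ℤ ℤ (subsetIncl φ₀.source) mA0 n
      (inv (relativeSingularHomology.map ℤ ℤ (chartRestrict x₀) mB0 n) (g.localClass p)) = _
    rw [← hd', ← hj₀e, ← ModuleCat.comp_apply,
      ← relativeSingularHomology.map_comp ℤ ℤ j₀ (subsetIncl φ₀.source) mj₀ mA0 n,
      relativeSingularHomology.map.congr_simp ℤ ℤ _ _ R1 (mA0.comp mj₀) n]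
  rw [hμ, hν, ← hεs]

end ChangeOfChart

/-! ### (B3) Assembly: local consistency and the discharge -/

section Assembly

variable (g : HomologicalOrientation ℤ (𝔼 n) n) (o : SmoothOrientation (𝓡 n) M)

/-- The forced classes are locally consistent (B1 + B2). [folklore] -/
theorem locallyConsistent_compatClass (x₀ : M) :
    ∃ K ∈ 𝓝 x₀, ∃ μK : localHomologyOfSet ℤ ℤ M K n,
      ∀ (y : M) (hy : y ∈ K), restrictToPoint ℤ ℤ hy n μK = compatClass g o y := by
  obtain ⟨K, hKn, hKU, m, hm⟩ := exists_restrictToPoint_eq_fixedChartClass g x₀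
  have hev := o.eventually_eq_iff x₀
  set V : Set M := {y | o y = o x₀ ↔ 0 < LinearMap.det
    ((tangentCoordChange (𝓡 n) y x₀ y : 𝔼 n →L[ℝ] 𝔼 n) : 𝔼 n →ₗ[ℝ] 𝔼 n)} with hV
  have hVn : V ∈ 𝓝 x₀ := hev
  refine ⟨K ∩ V, Filter.inter_mem hKn hVn,
    (signAt o x₀ : ℤ) • restrictLocal ℤ ℤ (inter_subset_left : K ∩ V ⊆ K) n m, fun y hy => ?_⟩
  rw [map_zsmul, restrictToPoint_restrictLocal_apply, hm y hy.1,
    compatClass_eq_smul_fixedChartClass g o (hKU hy.1) hy.2]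

end Assembly

end SmoothOrientation

/-! ### The discharge -/

section Holds

/-- Local notation: `𝔼 n` is the model Euclidean space `EuclideanSpace ℝ (Fin n)`. -/
local notation "𝔼 " n:arg => EuclideanSpace ℝ (Fin n)

variable {n : ℕ} {M : Type} [TopologicalSpace M] [ChartedSpace (𝔼 n) M] [IsManifold (𝓡 n) 1 M]

/-- **Discharge of `SmoothOrientation.existsUnique_isCompatible`** (Bredon, *Topology and
Geometry* (1993), VI.7, Thm. 7.15 with Prop. 7.14; Milnor–Stasheff 1974, App. A pp. 122–123):
on a Hausdorff `C¹` `n`-manifold every smooth orientation `o` has exactly one homological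
`ℤ`-orientation compatible with it, for every generator convention `g`. Existence: the classes
`μₓ = Aₓ Bₓ⁻¹ (εₓ g_{φₓ x})` are generators (images of `± g` under isomorphisms) and locally
consistent (`SmoothOrientation.locallyConsistent_compatClass`: chart transitions act by the sign
of their Jacobian); uniqueness: compatibility forces `μₓ`
(`SmoothOrientation.localClass_eq_of_isCompatibleAt`). [cite: Bredon1993, VI.7 Thm. 7.15] -/
theorem SmoothOrientation.existsUnique_isCompatible_holds :
    SmoothOrientation.existsUnique_isCompatible n M := by
  intro _ g o
  have hgen : ∀ x : M, ∃ e : localHomology ℤ ℤ M x n ≃ₗ[ℤ] ℤ,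
      e (SmoothOrientation.compatClass g o x) = 1 := fun x => by
    haveI := SmoothOrientation.isIso_pushChart (n := n) x n
    haveI := SmoothOrientation.isIso_pushIncl (n := n) x n
    have h1 := SmoothOrientation.exists_linearEquiv_units_smul
      (g.isGenerator (chartAt (𝔼 n) x x)) (SmoothOrientation.signAt o x)
    have h2 := exists_linearEquiv_apply_eq_one_of_linearEquiv
      (asIso (inv (SmoothOrientation.pushChart (n := n) x n))).toLinearEquiv h1
    exact exists_linearEquiv_apply_eq_one_of_linearEquiv
      (asIso (SmoothOrientation.pushIncl (n := n) x n)).toLinearEquiv h2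
  let μ : HomologicalOrientation ℤ M n :=
    { localClass := fun x => SmoothOrientation.compatClass g o x
      isGenerator := hgen
      locallyConsistent := fun x₀ => SmoothOrientation.locallyConsistent_compatClass g o x₀ }
  refine ⟨μ, fun x => SmoothOrientation.isCompatibleAt_of_localClass_eq rfl, fun μ' hμ' => ?_⟩
  exact HomologicalOrientation.ext (funext fun x =>
    SmoothOrientation.localClass_eq_of_isCompatibleAt (hμ' x))

end Holds

end Literature.Topology.FourManifolds
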